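import Literature.AnabelianGeometry.EtaleTheta.ThetaCoversTemperedOfSetting
import Literature.AnabelianGeometry.EtaleTheta.Discharge.Sec2HasMuLOfSetting
import Literature.AnabelianGeometry.EtaleTheta.Discharge.Sec2CompletionIndexAmbient
import Literature.AnabelianGeometry.EtaleTheta.DoubleUnderlineIotaStable
import Literature.AnabelianGeometry.EtaleTheta.ThetaRootOrbitsOfSetting
import HarnessLib

/-!
# [EtTh] §2 at the §1 model: the profinite `Π_{X̲̲} := cl(ιC(inclX(Π^tp_{X̲̲})))` of a CHOSEN `X̲̲`
# (proof-only lemmas for the cover built FROM `C.Huu`; census C10, W3-L2-02 «§2 COVER/ORBIT MODEL»)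

Mochizuki, *The étale theta function and its Frobenioid-theoretic manifestations*, Publ. RIMS **45**
(2009) [EtTh], §2: Def. 2.1 p. 36, Prop. 2.2 pp. 36–38, Def. 2.3 p. 38, Def. 2.5 (i) p. 39 ("compatible
with the `{±1}`-structure"; "determined by a splitting of `D_x → G_K`"), Prop. 2.4 p. 38 (PRIMS PDF pages,
printed `+226`) [cite: MochizukiEtTh2009, Def 2.3 p.38].

Cell abc-iut, layer L2, seat abc-iut-L2-d3 (gen 6). PROOF-ONLY (0 definitions). abc-iut-L2-t8's
`EtaleThetaData.DoubleUnderline E l` (the CHOICE `X̲̲` through `Π^tp_{X̲̲} = C.Huu ≤ Π^tp_X`) and the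
census-C10 predicates `IotaStable` / `CuspAdapted` (`DoubleUnderlineIotaStable.lean`) are the inputs; this
file proves what the ASSEMBLY of a `TemperedCoverData` FROM `C.Huu` (next file of this seat,
`ThetaCoversTemperedOfHuu.lean`) needs about the profinite subgroup
`H := cl(ιC(inclX(Π^tp_{X̲̲}))) ⊆ P_C` over a profinite completion `ιC : Π^tp_C → P_C`:

* §1 (root level) **`barKerHat = cl(toHat(barKerTp))`**: the profinite `Ker(Δ_X ↠ Δ̄_X)` of
  abc-iut-L2-t10's `ThetaCoversModelDefs` IS the closure of the image of this seat's tempered one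
  (`BarDeltaOfSetting.barKerTp`) — the `barKer` companion of gen 5's `barThetaHat_eq_closure_map_barThetaTp`
  (triple commutators are limits of tempered `[t, d]`, `t ∈ Δ̄_Θ`-preimage, `d ∈ Δ^tp_X`,
  `barThetaTp_central`; `l`-th powers of `Δ_X` are limits of tempered `l`-th powers);
* §2 (tempered) **`Π^tp_{X̲̲} ∩ barThetaTp ≤ barKerTp`** GIVEN `barKerTp ≤ Π^tp_{X̲̲}` ("`Δ_{X̲̲}` meets `Δ̄_Θ`
  trivially": field `map_toTheta_Huu` "`Huu.map toTheta ⊓ Δ_Θ = l·Δ_Θ`");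
* §3 (model, `P_C`-level) `H ≤ Π_X̲ := cl(ιC(inclX(Π^tp_X̲)))`, `H` open, `ιC⁻¹(H) = inclX(Π^tp_{X̲̲})`,
  `[Π_X̲ : H] = l`, `[P_C : H] = 2·l²`, `H ↠ G_K`; **`barKer ≤ H`** and **`H ∩ barTheta ≤ barKer`**
  (from the tempered clause `barKerTp ≤ Huu` — see HONEST RESIDUE); `H` is normalised by `ιC g` when
  `C.IotaStable (e.conjX g)` (Def. 2.5 (i)(b)); `H ∩ D_x ↠ G_K` when `C.CuspAdapted x`.

HONEST RESIDUE: the binder `hK : barKerTp l ≤ C.Huu` ("`Π^tp_{X̲̲} ⊇ Ker(Δ^tp_X ↠ Δ̄_X)`", i.e. `X̲̲ → X`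
factors through the `Δ̄_X`-level: print's `Π_{X̲̲} = S·E` with `E ⊇ Ker`, Prop. 2.2 (i)/(ii), Def. 2.3) is a
clause about the DATUM `X̲̲` that abc-iut-L2-t8's `DoubleUnderline` does not record (GAP-LEDGER row by this
seat); it is NOT derived here from `DoubleUnderline`'s fields. [EtTh] is refereed; nothing here asserts that
a `MuTwoSetting` exists; no side is taken on [IUTchIII] Cor. 3.12; typed ≠ proved elsewhere.
-/

noncomputable section

namespace Literature.AnabelianGeometry.EtaleTheta

open Literature.AnabelianGeometry.SemiGraphs ThetaCovers
open _root_.Topology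

/-! ## §0. Two generic closure lemmas -/

/-- The image of the closure is contained in the closure of the image, for a continuous homomorphism
(subgroup form of `image_closure_subset_closure_image`). [cite: MochizukiEtTh2009, Prop 2.4 p.38] -/
theorem Subgroup.map_topologicalClosure_le_of_continuous {G G' : Type*} [Group G] [TopologicalSpace G]
    [IsTopologicalGroup G] [Group G'] [TopologicalSpace G'] [IsTopologicalGroup G'] (f : G →* G')
    (hf : Continuous f) (A : Subgroup G) : A.topologicalClosure.map f ≤ (A.map f).topologicalClosure := by
  rintro _ ⟨a, ha, rfl⟩
  change f a ∈ closure ((A.map f : Subgroup G') : Set G')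
  rw [Subgroup.coe_map]
  exact image_closure_subset_closure_image hf ⟨a, ha, rfl⟩

/-- Conjugation commutes with topological closure: `c·cl(A)·c⁻¹ = cl(c·A·c⁻¹)` (conjugation is a
homeomorphism of the topological group). [cite: MochizukiEtTh2009, Def 2.1 p.36] -/
theorem Subgroup.map_conj_topologicalClosure_eq {G : Type*} [Group G] [TopologicalSpace G]
    [IsTopologicalGroup G] (A : Subgroup G) (c : G) :
    A.topologicalClosure.map (MulAut.conj c).toMonoidHom =
      (A.map (MulAut.conj c).toMonoidHom).topologicalClosure := by
  apply SetLike.coe_injective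
  let φ : G ≃ₜ G := (Homeomorph.mulLeft c).trans (Homeomorph.mulRight c⁻¹)
  have hco : ((MulAut.conj c).toMonoidHom : G → G) = φ := by
    ext x
    rfl
  rw [Subgroup.coe_map, Subgroup.topologicalClosure_coe, Subgroup.topologicalClosure_coe,
    Subgroup.coe_map, hco]
  exact φ.image_closure _

namespace ThetaSetting

variable {p : ℕ} [Fact p.Prime] (D : ThetaSetting p) (l : ℕ)

/-! ## §1. The profinite `Ker(Δ_X ↠ Δ̄_X)` is the closure of the tempered one -/

/-- **`barKerHat ≤ cl(toHat(barKerTp))`**: the generators of the profinite `Ker(Δ_X ↠ Δ̄_X)` — triple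
commutators `[u, c]`, `u ∈ [Δ_X,Δ_X] ≤ Δ̄_Θ`-preimage `= cl(toHat(barThetaTp))`, `c ∈ Δ_X = cl(toHat(Δ^tp_X))`,
and `l`-th powers of `Δ_X` — are limits of images of tempered elements of `barKerTp`
(`barThetaTp_central`, `pow_mem_barKerTp`). [cite: MochizukiEtTh2009, Def 2.1 p.35] -/
theorem barKerHat_le_closure_map_barKerTp :
    D.barKerHat l ≤ ((D.barKerTp l).map D.toHat.toMonoidHom).topologicalClosure := by
  set K := ((D.barKerTp l).map D.toHat.toMonoidHom).topologicalClosure with hK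
  have hKcl : IsClosed (K : Set D.PiHat) := Subgroup.isClosed_topologicalClosure _
  set A : Set D.PiHat := D.toHat '' (D.DeltaTemp : Set D.PiTemp) with hA
  set B : Set D.PiHat := D.toHat '' (D.barThetaTp l : Set D.PiTemp) with hB
  have hΔ : (D.DeltaHat : Set D.PiHat) = closure A := D.coe_deltaHat_eq_closure
  have hΘ : (D.barThetaHat l : Set D.PiHat) = closure B := by
    rw [D.barThetaHat_eq_closure_map_barThetaTp l, Subgroup.topologicalClosure_coe, Subgroup.coe_map]
    rfl
  -- triple commutators
  have h1 : ⁅⁅D.DeltaHat, D.DeltaHat⁆, D.DeltaHat⁆ ≤ K := by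
    rw [Subgroup.commutator_le]
    intro u hu c hc
    have hu' : u ∈ closure B := by
      rw [← hΘ]
      exact D.commutator_le_barThetaHat l hu
    have hc' : c ∈ closure A := by
      rw [← hΔ]
      exact hc
    have hF : Continuous fun x : D.PiHat × D.PiHat => x.1 * x.2 * x.1⁻¹ * x.2⁻¹ := by fun_prop
    have huc : (u, c) ∈ closure (B ×ˢ A) := by
      rw [closure_prod_eq]
      exact ⟨hu', hc'⟩
    have himg : (fun x : D.PiHat × D.PiHat => x.1 * x.2 * x.1⁻¹ * x.2⁻¹) '' (B ×ˢ A) ⊆ (K : Set D.PiHat) := by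
      rintro _ ⟨⟨_, _⟩, ⟨⟨t, ht, rfl⟩, ⟨d, hd, rfl⟩⟩, rfl⟩
      refine Subgroup.le_topologicalClosure _ ⟨t * d * t⁻¹ * d⁻¹, D.barThetaTp_central l ht hd, ?_⟩
      rw [map_mul, map_mul, map_mul, map_inv, map_inv]
      rfl
    have := image_closure_subset_closure_image hF ⟨(u, c), huc, rfl⟩
    exact hKcl.closure_subset_iff.2 himg this
  -- `l`-th powers
  have h2 : D.deltaHatPow l ≤ K := by
    rw [D.deltaHatPow_eq_closure l, Subgroup.closure_le]
    rintro _ ⟨y, hy, rfl⟩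
    have hG : Continuous fun x : D.PiHat => x ^ l := continuous_pow l
    have hy' : y ∈ closure A := by
      rw [← hΔ]
      exact hy
    have himg : (fun x : D.PiHat => x ^ l) '' A ⊆ (K : Set D.PiHat) := by
      rintro _ ⟨_, ⟨x, hx, rfl⟩, rfl⟩
      refine Subgroup.le_topologicalClosure _ ⟨x ^ l, D.pow_mem_barKerTp l hx, ?_⟩
      rw [map_pow]
      rfl
    have := image_closure_subset_closure_image hG ⟨y, hy', rfl⟩
    exact hKcl.closure_subset_iff.2 himg this
  exact Subgroup.topologicalClosure_minimal _ (sup_le h1 h2) hKcl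

/-- **`barKerHat = cl(toHat(barKerTp))`**: the profinite `Ker(Δ_X ↠ Δ̄_X)` IS the closure of the image of
the tempered one (with gen 4's `barKerTp_le_comap_barKerHat`). [cite: MochizukiEtTh2009, Def 2.1 p.35] -/
theorem barKerHat_eq_closure_map_barKerTp :
    D.barKerHat l = ((D.barKerTp l).map D.toHat.toMonoidHom).topologicalClosure := by
  refine le_antisymm (D.barKerHat_le_closure_map_barKerTp l)
    (Subgroup.topologicalClosure_minimal _ ?_ (D.isClosed_barKerHat l))
  rintro _ ⟨x, hx, rfl⟩
  exact D.barKerTp_le_comap_barKerHat l hx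

/-! ## §2. Tempered level: `Π^tp_{X̲̲} ∩ barThetaTp ≤ barKerTp` -/

namespace EtaleThetaData.DoubleUnderline

variable {D} {E : D.EtaleThetaData} {l} (C : E.DoubleUnderline l)

/-- **`Π^tp_{X̲̲} ∩ (Δ̄_Θ-preimage) ≤ Ker(Δ^tp_X ↠ Δ̄_X)`**, granted `Ker(Δ^tp_X ↠ Δ̄_X) ≤ Π^tp_{X̲̲}`: an element
`t ∈ Π^tp_{X̲̲}` with `θ(t) = q·z`, `q ∈ ⟨l-th powers⟩`, `z ∈ Δ_Θ`, has `z = θ(y⁻¹ t) ∈ θ(Π^tp_{X̲̲}) ∩ Δ_Θ = l·Δ_Θ`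
(`y ∈ barKerTp ≤ Π^tp_{X̲̲}` a lift of `q`; field `map_toTheta_Huu`), so `θ(t) ∈ ⟨l-th powers⟩` ("`Δ_{X̲̲}` maps
isomorphically onto `Δ̄^ell`", Prop. 2.2 (ii)). [cite: MochizukiEtTh2009, Prop 2.2 (ii) p.37] -/
theorem inf_barThetaTp_le_barKerTp (hK : D.barKerTp l ≤ C.Huu) : C.Huu ⊓ D.barThetaTp l ≤ D.barKerTp l := by
  rintro t ⟨htH, htΘ⟩
  obtain ⟨htΔ, htP⟩ := (D.mem_barThetaTp_iff l).1 htΘ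
  haveI := D.powTheta_normal l
  obtain ⟨q, hq, z, hz, hqz⟩ := Subgroup.mem_sup_of_normal_left.1 htP
  obtain ⟨y, hy, hyq⟩ := (D.powTheta_le_dtpTheta l) hq
  have hyK : y ∈ D.barKerTp l := (D.mem_barKerTp_iff l).2 ⟨hy, by rw [hyq]; exact hq⟩
  have hyt : y⁻¹ * t ∈ C.Huu := C.Huu.mul_mem (C.Huu.inv_mem (hK hyK)) htH
  have hz' : z ∈ C.Huu.map D.toTheta ⊓ D.DeltaTheta := by
    refine ⟨⟨y⁻¹ * t, hyt, ?_⟩, hz⟩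
    rw [map_mul, map_inv, hyq, ← hqz, inv_mul_cancel_left]
  rw [C.map_toTheta_Huu] at hz'
  refine (D.mem_barKerTp_iff l).2 ⟨htΔ, ?_⟩
  rw [← hqz]
  exact (D.powTheta l).mul_mem hq (D.lDeltaTheta_le_powTheta l hz')

end EtaleThetaData.DoubleUnderline

end ThetaSetting

/-! ## §3. Model level: `H := cl(ιC(inclX(Π^tp_{X̲̲}))) ⊆ P_C` -/

namespace MuTwoSetting.CLevelData

variable {p : ℕ} [Fact p.Prime] {M : MuTwoSetting p}
variable {PC : Type} [Group PC] [TopologicalSpace PC] [IsTopologicalGroup PC] [T2Space PC]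

/-- `incl ∘ toHat = ιC ∘ inclX` on subgroups: `incl(toHat(A)) = ιC(inclX(A))` for `A ≤ Π^tp_X`
(`piCDataOf_incl_toHat`). [cite: MochizukiEtTh2009, Def 2.1 p.36] -/
theorem map_toHat_map_incl (e : M.CLevelData) (ιC : M.GtpC →ₜ* PC) (hιC : IsProfiniteCompletion ιC)
    (A : Subgroup M.PiTemp) :
    (A.map M.toHat.toMonoidHom).map (e.piCDataOf ιC hιC).incl.toMonoidHom = (A.map M.inclX).map ιC.toMonoidHom := by
  rw [Subgroup.map_map, Subgroup.map_map]
  congr 1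
  ext x
  exact e.piCDataOf_incl_toHat ιC hιC x

omit [T2Space PC] in
/-- **`H ≤ Π_X̲ := cl(ιC(inclX(Π^tp_X̲)))`** (`Π^tp_{X̲̲} ≤ Π^tp_X̲`, abc-iut-L2-t7's `Huu_le_GtpXu`).
[cite: MochizukiEtTh2009, Def 2.5 (i) p.39] -/
theorem closureHuu_le_closureXu (ιC : M.GtpC →ₜ* PC) {E : M.toThetaSetting.EtaleThetaData} {l : ℕ}
    (C : E.DoubleUnderline l) :
    ((C.Huu.map M.inclX).map ιC.toMonoidHom).topologicalClosure ≤
      (((M.GtpXu l).map M.inclX).map ιC.toMonoidHom).topologicalClosure :=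
  Subgroup.topologicalClosure_mono (Subgroup.map_mono (Subgroup.map_mono C.Huu_le_GtpXu))

/-- `H ≤ Π_X`. [cite: MochizukiEtTh2009, Def 2.3 p.38] -/
theorem closureHuu_le_PiX (e : M.CLevelData) (ιC : M.GtpC →ₜ* PC) (hιC : IsProfiniteCompletion ιC)
    {E : M.toThetaSetting.EtaleThetaData} {l : ℕ} (C : E.DoubleUnderline l) :
    ((C.Huu.map M.inclX).map ιC.toMonoidHom).topologicalClosure ≤ (e.piCDataOf ιC hιC).PiX :=
  closure_map_inclX_le_range ιC hιC _ (e.piCDataOf_incl_toHat ιC hιC) _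

omit [T2Space PC] in
/-- **`H` is open in `P_C`** (`Π^tp_{X̲̲}` is open of finite index `l²` in `Π^tp_X`).
[cite: MochizukiEtTh2009, Def 2.3 p.38] -/
theorem isOpen_closureHuu (e : M.CLevelData) (ιC : M.GtpC →ₜ* PC) (hιC : IsProfiniteCompletion ιC)
    {E : M.toThetaSetting.EtaleThetaData} {l : ℕ} (C : E.DoubleUnderline l) :
    IsOpen ((((C.Huu.map M.inclX).map ιC.toMonoidHom).topologicalClosure : Subgroup PC) : Set PC) := by
  haveI := C.finiteIndex_Huu
  exact e.isOpen_closure_map_inclX ιC hιC C.Huu C.isOpen_Huu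

omit [T2Space PC] in
/-- **`ιC⁻¹(H) = inclX(Π^tp_{X̲̲})`** — the tempered `Π^tp_{X̲̲}` of the covering with profinite group `H` IS
`C.Huu` (the shape of abc-iut-L2-t2's `OrbitEmbedding.map_Huu`). [cite: MochizukiEtTh2009, Prop 2.4 p.38] -/
theorem comap_closureHuu (e : M.CLevelData) (ιC : M.GtpC →ₜ* PC) (hιC : IsProfiniteCompletion ιC)
    {E : M.toThetaSetting.EtaleThetaData} {l : ℕ} (C : E.DoubleUnderline l) :
    (((C.Huu.map M.inclX).map ιC.toMonoidHom).topologicalClosure).comap ιC.toMonoidHom = C.Huu.map M.inclX := by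
  haveI := C.finiteIndex_Huu
  exact e.comap_closure_map_inclX ιC hιC C.Huu C.isOpen_Huu

omit [T2Space PC] in
/-- **`[P_C : H] = 2·l²`** (`[Π^tp_X : Π^tp_{X̲̲}] = l²`, `[Π^tp_C : Π^tp_X] = 2`).
[cite: MochizukiEtTh2009, Rmk 2.3.1 p.38] -/
theorem index_closureHuu (e : M.CLevelData) (ιC : M.GtpC →ₜ* PC) (hιC : IsProfiniteCompletion ιC)
    {E : M.toThetaSetting.EtaleThetaData} {l : ℕ} (C : E.DoubleUnderline l) :
    (((C.Huu.map M.inclX).map ιC.toMonoidHom).topologicalClosure).index = 2 * l ^ 2 := by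
  haveI := C.finiteIndex_Huu
  rw [e.index_closure_map_inclX ιC hιC C.Huu C.isOpen_Huu, C.index_Huu]

omit [T2Space PC] in
/-- **`[Π_X̲ : H] = l`** ("`X̲̲ → X̲` extracts the second copy of `ℤ/lℤ`"; abc-iut-L2-t8's ambient
`relIndex_closure_map_map_Huu_GtpXu`). [cite: MochizukiEtTh2009, Rmk 2.3.1 p.38] -/
theorem relIndex_closureHuu_closureXu (e : M.CLevelData) (ιC : M.GtpC →ₜ* PC)
    (hιC : IsProfiniteCompletion ιC) {E : M.toThetaSetting.EtaleThetaData} {l : ℕ} (C : E.DoubleUnderline l) :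
    (((C.Huu.map M.inclX).map ιC.toMonoidHom).topologicalClosure).relIndex
        ((((M.GtpXu l).map M.inclX).map ιC.toMonoidHom).topologicalClosure) = l := by
  haveI : (⟨M.inclX, M.continuous_inclX⟩ : M.PiTemp →ₜ* M.GtpC).toMonoidHom.range.FiniteIndex :=
    ⟨by rw [show (⟨M.inclX, M.continuous_inclX⟩ : M.PiTemp →ₜ* M.GtpC).toMonoidHom = M.inclX from rfl,
      M.index_range_inclX]; decide⟩
  exact C.relIndex_closure_map_map_Huu_GtpXu (j := ⟨M.inclX, M.continuous_inclX⟩) hιC M.injective_inclX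
    e.isOpenEmbedding_inclX.isOpenMap

/-- **`H ↠ G_K`** ("`G_K ≅ Π_{X̲̲}/Δ_{X̲̲}`", Prop. 2.2 (iii); from `map_aug_Huu` and `aug ∘ ιC ∘ inclX = aug_X`).
[cite: MochizukiEtTh2009, Prop 2.2 (iii) p.37] -/
theorem exists_mem_closureHuu_augGK_eq (e : M.CLevelData) (ιC : M.GtpC →ₜ* PC)
    (hιC : IsProfiniteCompletion ιC) {E : M.toThetaSetting.EtaleThetaData} {l : ℕ} (C : E.DoubleUnderline l)
    (γ : M.GK) :
    ∃ h ∈ ((C.Huu.map M.inclX).map ιC.toMonoidHom).topologicalClosure, (e.piCDataOf ιC hιC).augGK h = γ := by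
  have hγ : (γ : GQp p) ∈ C.Huu.map M.aug.toMonoidHom := by
    rw [C.map_aug_Huu]
    exact γ.2
  obtain ⟨x, hx, hxγ⟩ := hγ
  refine ⟨ιC (M.inclX x), Subgroup.le_topologicalClosure _ ⟨M.inclX x, ⟨x, hx, rfl⟩, rfl⟩, Subtype.ext ?_⟩
  rw [ThetaSetting.PiCData.coe_augGK_apply, e.piCDataOf_aug_inclX]
  exact hxγ

/-- Every `g ∈ Π_X̲` factors as `g = h·d` with `h ∈ H` and `d ∈ Π_X̲ ∩ Δ_C = Δ_X̲` (`H ↠ G_K`, `H ≤ Π_X̲`).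
[cite: MochizukiEtTh2009, Prop 2.2 (ii) p.37] -/
theorem exists_closureHuu_mul_delta_eq (e : M.CLevelData) (ιC : M.GtpC →ₜ* PC)
    (hιC : IsProfiniteCompletion ιC) {E : M.toThetaSetting.EtaleThetaData} {l : ℕ} (C : E.DoubleUnderline l)
    {g : PC} (hg : g ∈ (((M.GtpXu l).map M.inclX).map ιC.toMonoidHom).topologicalClosure) :
    ∃ h ∈ ((C.Huu.map M.inclX).map ιC.toMonoidHom).topologicalClosure,
      ∃ d ∈ (((M.GtpXu l).map M.inclX).map ιC.toMonoidHom).topologicalClosure ⊓ (e.piCDataOf ιC hιC).augGK.ker,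
        g = h * d := by
  obtain ⟨h, hh, hhγ⟩ := e.exists_mem_closureHuu_augGK_eq ιC hιC C ((e.piCDataOf ιC hιC).augGK g)
  refine ⟨h, hh, h⁻¹ * g, Subgroup.mem_inf.2 ⟨Subgroup.mul_mem _ (Subgroup.inv_mem _
    (closureHuu_le_closureXu ιC C hh)) hg, ?_⟩, by group⟩
  rw [MonoidHom.mem_ker, map_mul, map_inv, hhγ, inv_mul_cancel]

/-- **`Ker(Δ_X ↠ Δ̄_X) ≤ H`** at the model, from the tempered clause `barKerTp ≤ Π^tp_{X̲̲}` (`barKer` is the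
image of `barKerHat = cl(toHat(barKerTp))`, §1). [cite: MochizukiEtTh2009, Prop 2.2 (i) p.37] -/
theorem barKer_le_closureHuu (e : M.CLevelData) (ιC : M.GtpC →ₜ* PC) (hιC : IsProfiniteCompletion ιC)
    {E : M.toThetaSetting.EtaleThetaData} {l : ℕ} (C : E.DoubleUnderline l)
    (op : M.toThetaSetting.OncePuncturedData) (hK : M.barKerTp l ≤ C.Huu) :
    (e.piCDataOf ιC hιC).barKer l ≤ ((C.Huu.map M.inclX).map ιC.toMonoidHom).topologicalClosure := by
  have hc : Continuous (e.piCDataOf ιC hιC).incl.toMonoidHom := map_continuous (e.piCDataOf ιC hιC).incl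
  rw [(e.piCDataOf ιC hιC).barKer_eq_map l op, M.barKerHat_eq_closure_map_barKerTp l]
  refine (Subgroup.map_topologicalClosure_le_of_continuous _ hc _).trans ?_
  rw [e.map_toHat_map_incl ιC hιC]
  exact Subgroup.topologicalClosure_mono (Subgroup.map_mono (Subgroup.map_mono hK))

/-- **`H ∩ (Δ̄_Θ-preimage) ≤ Ker(Δ_X ↠ Δ̄_X)`** at the model, from the tempered clause `barKerTp ≤ Π^tp_{X̲̲}`:
`H` is OPEN, so `H ∩ cl(ιC(inclX(barThetaTp))) ⊆ cl(H ∩ ιC(inclX(barThetaTp))) = cl(ιC(inclX(Huu ∩ barThetaTp)))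
⊆ cl(ιC(inclX(barKerTp))) ⊆ barKer` (§2 and `ιC⁻¹(H) = inclX(Huu)`). [cite: MochizukiEtTh2009, Prop 2.2 (ii) p.37] -/
theorem closureHuu_inf_barTheta_le_barKer (e : M.CLevelData) (ιC : M.GtpC →ₜ* PC)
    (hιC : IsProfiniteCompletion ιC) {E : M.toThetaSetting.EtaleThetaData} {l : ℕ} (C : E.DoubleUnderline l)
    (op : M.toThetaSetting.OncePuncturedData) (hK : M.barKerTp l ≤ C.Huu) :
    ((C.Huu.map M.inclX).map ιC.toMonoidHom).topologicalClosure ⊓ (e.piCDataOf ιC hιC).barTheta l ≤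
      (e.piCDataOf ιC hιC).barKer l := by
  set I := e.piCDataOf ιC hιC with hI
  set H := ((C.Huu.map M.inclX).map ιC.toMonoidHom).topologicalClosure with hH
  set B : Subgroup PC := ((M.barThetaTp l).map M.inclX).map ιC.toMonoidHom with hB
  have hc : Continuous I.incl.toMonoidHom := map_continuous I.incl
  rintro h ⟨hhH, hhΘ⟩
  have hB' : h ∈ B.topologicalClosure := by
    rw [I.barTheta_eq_map l op, M.barThetaHat_eq_closure_map_barThetaTp l] at hhΘ
    rw [hB, ← e.map_toHat_map_incl ιC hιC]
    exact Subgroup.map_topologicalClosure_le_of_continuous _ hc _ hhΘ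
  have hmem : h ∈ closure ((H : Set PC) ∩ (B : Set PC)) := by
    have h1 : h ∈ (H : Set PC) ∩ closure (B : Set PC) := by
      refine ⟨hhH, ?_⟩
      rw [← Subgroup.topologicalClosure_coe]
      exact hB'
    exact (e.isOpen_closureHuu ιC hιC C).inter_closure h1
  have hsub : (H : Set PC) ∩ (B : Set PC) ⊆ (I.barKer l : Set PC) := by
    rintro y ⟨hyH, hyB⟩
    obtain ⟨_, ⟨t, ht, rfl⟩, rfl⟩ := hyB
    have htH : M.inclX t ∈ C.Huu.map M.inclX := by
      rw [← e.comap_closureHuu ιC hιC C]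
      exact hyH
    obtain ⟨t', ht', htt'⟩ := htH
    obtain rfl : t' = t := M.injective_inclX htt'
    have htK : t' ∈ M.barKerTp l := C.inf_barThetaTp_le_barKerTp hK ⟨ht', ht⟩
    show ιC (M.inclX t') ∈ I.barKer l
    rw [I.barKer_eq_map l op]
    exact ⟨M.toHat t', M.barKerTp_le_comap_barKerHat l htK, e.piCDataOf_incl_toHat ιC hιC t'⟩
  exact (I.isClosed_barKer l).closure_subset_iff.2 hsub hmem

omit [T2Space PC] in
/-- **Def. 2.5 (i)(b) at the model: `ιC g` normalises `H`** when `X̲̲` is stable under the restricted inner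
automorphism `e.conjX g` (abc-iut-L2-t8's `IotaStable`; `iotaStable_conjX_iff`: `g` normalises
`inclX(Π^tp_{X̲̲})` in `Π^tp_C`; conjugation commutes with `ιC` and with closure).
[cite: MochizukiEtTh2009, Def 2.5 (i) p.39] -/
theorem map_conj_closureHuu (e : M.CLevelData) (ιC : M.GtpC →ₜ* PC) {E : M.toThetaSetting.EtaleThetaData}
    {l : ℕ} (C : E.DoubleUnderline l) {g : M.GtpC} (hι : C.IotaStable (e.conjX g)) :
    (((C.Huu.map M.inclX).map ιC.toMonoidHom).topologicalClosure).map (MulAut.conj (ιC g)).toMonoidHom =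
      ((C.Huu.map M.inclX).map ιC.toMonoidHom).topologicalClosure := by
  have hcomp : (MulAut.conj (ιC g)).toMonoidHom.comp ιC.toMonoidHom =
      ιC.toMonoidHom.comp (MulAut.conj g).toMonoidHom := by
    ext x
    simp only [MonoidHom.comp_apply, MulEquiv.coe_toMonoidHom, MulAut.conj_apply, map_mul, map_inv]
    rfl
  have h0 := (e.iotaStable_conjX_iff C g).1 hι
  have h1 : ((C.Huu.map M.inclX).map ιC.toMonoidHom).map (MulAut.conj (ιC g)).toMonoidHom =
      (C.Huu.map M.inclX).map ιC.toMonoidHom := by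
    calc ((C.Huu.map M.inclX).map ιC.toMonoidHom).map (MulAut.conj (ιC g)).toMonoidHom
        = (C.Huu.map M.inclX).map ((MulAut.conj (ιC g)).toMonoidHom.comp ιC.toMonoidHom) :=
          Subgroup.map_map _ _ _
      _ = (C.Huu.map M.inclX).map (ιC.toMonoidHom.comp (MulAut.conj g).toMonoidHom) := by rw [hcomp]
      _ = ((C.Huu.map M.inclX).map (MulAut.conj g).toMonoidHom).map ιC.toMonoidHom :=
          (Subgroup.map_map _ _ _).symm
      _ = (C.Huu.map M.inclX).map ιC.toMonoidHom := by rw [h0]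
  rw [Subgroup.map_conj_topologicalClosure_eq, h1]

omit [T2Space PC] in
/-- Membership form: `(ιC g)·h·(ιC g)⁻¹ ∈ H` for `h ∈ H`, when `C.IotaStable (e.conjX g)`.
[cite: MochizukiEtTh2009, Def 2.5 (i) p.39] -/
theorem conj_mem_closureHuu (e : M.CLevelData) (ιC : M.GtpC →ₜ* PC) {E : M.toThetaSetting.EtaleThetaData}
    {l : ℕ} (C : E.DoubleUnderline l) {g : M.GtpC} (hι : C.IotaStable (e.conjX g)) {h : PC}
    (hh : h ∈ ((C.Huu.map M.inclX).map ιC.toMonoidHom).topologicalClosure) :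
    ιC g * h * (ιC g)⁻¹ ∈ ((C.Huu.map M.inclX).map ιC.toMonoidHom).topologicalClosure := by
  have := (e.map_conj_closureHuu ιC C hι).le ⟨h, hh, rfl⟩
  simpa only [MulEquiv.coe_toMonoidHom, MulAut.conj_apply] using this

omit [T2Space PC] in
/-- … and `(ιC g)⁻¹·h·(ιC g) ∈ H`. [cite: MochizukiEtTh2009, Def 2.5 (i) p.39] -/
theorem conj_inv_mem_closureHuu (e : M.CLevelData) (ιC : M.GtpC →ₜ* PC)
    {E : M.toThetaSetting.EtaleThetaData} {l : ℕ} (C : E.DoubleUnderline l) {g : M.GtpC}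
    (hι : C.IotaStable (e.conjX g)) {h : PC}
    (hh : h ∈ ((C.Huu.map M.inclX).map ιC.toMonoidHom).topologicalClosure) :
    (ιC g)⁻¹ * h * ιC g ∈ ((C.Huu.map M.inclX).map ιC.toMonoidHom).topologicalClosure := by
  have hmem : h ∈ (((C.Huu.map M.inclX).map ιC.toMonoidHom).topologicalClosure).map
      (MulAut.conj (ιC g)).toMonoidHom := by
    rw [e.map_conj_closureHuu ιC C hι]
    exact hh
  obtain ⟨h', hh', hh'h⟩ := hmem
  have : (ιC g)⁻¹ * h * ιC g = h' := by
    rw [← hh'h]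
    simp only [MulEquiv.coe_toMonoidHom, MulAut.conj_apply]
    group
  rw [this]
  exact hh'

/-- **Def. 2.5 (i)(b) at the model, cusp clause: `H ∩ D_x ↠ G_K`** when `X̲̲` is adapted to the cusp `x`
(abc-iut-L2-t8's `CuspAdapted`: `D_x ∩ Π^tp_{X̲̲} ↠ G_K`) — the datum from which the splitting
`S := H ∩ (D_x·Ker)` of `D̄_x ↠ G_K` is DEFINED in `ThetaCoversTemperedOfHuu`.
[cite: MochizukiEtTh2009, Def 2.5 (i) p.39] -/
theorem exists_mem_closureHuu_inf_Dx_augGK_eq (e : M.CLevelData) (ιC : M.GtpC →ₜ* PC)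
    (hιC : IsProfiniteCompletion ιC) {E : M.toThetaSetting.EtaleThetaData} {l : ℕ} (C : E.DoubleUnderline l)
    {x : M.Pt} (hA : C.CuspAdapted x) (γ : M.GK) :
    ∃ s ∈ ((C.Huu.map M.inclX).map ιC.toMonoidHom).topologicalClosure ⊓ (e.piCDataOf ιC hιC).Dx x,
      (e.piCDataOf ιC hιC).augGK s = γ := by
  obtain ⟨g, ⟨hgD, hgH⟩, hgγ⟩ := hA.exists_mem_aug_eq γ.2
  refine ⟨ιC (M.inclX g), Subgroup.mem_inf.2 ⟨Subgroup.le_topologicalClosure _ ⟨M.inclX g, ⟨g, hgH, rfl⟩, rfl⟩,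
    ?_⟩, Subtype.ext ?_⟩
  · show ιC (M.inclX g) ∈
      (((M.decomp x).map M.toHat.toMonoidHom).topologicalClosure).map (e.piCDataOf ιC hιC).incl.toMonoidHom
    exact ⟨M.toHat g, Subgroup.le_topologicalClosure _ ⟨g, hgD, rfl⟩, e.piCDataOf_incl_toHat ιC hιC g⟩
  · rw [ThetaSetting.PiCData.coe_augGK_apply, e.piCDataOf_aug_inclX]
    exact hgγ

end MuTwoSetting.CLevelData

end Literature.AnabelianGeometry.EtaleTheta

end
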